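import Summits.QuantumFields.YangMills.Theorems.UnitScaleTiltFluctuationComparisonRegPrGlobalSlackKernelLegChi
import Summits.QuantumFields.YangMills.Theorems.UnitScaleTiltFluctuationComparisonRegPrGlobalSlackCanonicalOnChiChi
import HarnessLib

/-!
# `UnitScaleTiltFluctuationComparisonRegPrGlobalSlackKernelLegOnChi` — STUB (i*)χ OF v5kC IN PRINT'S LEG CURRENCY (43)×(44): THE LEG ROWS AT THE χ-RECORD'S CANONICAL POLYMERISATION WITH
# THE THREE CONFIGURATION ROWS READ ON PRINT'S χ, BY NAME (crux `FluctuationComparisonRegPrIntL`, stmt-QuantumFields-20520, skeleton v5kC (OWNER C3), STUB (i*)χ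
# `stub_smallBlocksSlackOnChiAllChi` (odd `L < 7`, every margin); width-lever lane B «(R1) print's χ of [Balaban1985UV3] (47) back — the small-block case structurally», seat ym-ust-19935-r1 g4)

THE POINT.  After the core port both χ-stubs read the K1a chart rows at the χ-record's canonical polymerisation: 3⁗χ in lane A's final LEG currency (`K1aLegRowsRChi`, `…KernelLegChi`),
(i*)χ so far only in the sup-norm chart currency (`K1aChartRowsOnChiChi`, `…CanonicalOnChiChi`).  Lane A's transfer «leg rows for `(Φ, B)` ⟹ sup-norm rows for the rescaled pair
`(Φ∘D_w, D_w⁻¹B)`» (`…KernelLegWeights` §4, `…LegSummableT`) is POINTWISE in the window datum, so it threads a window sub-predicate `S` unchanged: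

* §1 the two configuration leg rows ON `S`: **`CfgDistΦOn S`**, **`CfgDistCauchyΦOn S`** ((44) distance form / its two-run Cauchy form, asked only at doubly-`S`-good window data;
  `…_of_full`);
* §2 the transfers ON `S`: `cfgSizeΦOn_rescaleW`, `cfgCauchyΦOn_rescaleW` (lane A's `cfgSizeΦ_rescaleW`/`cfgCauchyΦ_rescaleW` verbatim with the two `S`-hypotheses threaded),
  `remainderSmallΦOn_mono` (decay monotonicity on `S`);
* §3 **`K1aLegRowsGOnChiChi L μ 𝔠 a₀ a₁ a`** — `K1aLegRowsGChi` (geometry discharged at `canonLegDist F`) with, for every `0 < ε₀ ≤ a₀`, the residual/configuration rows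
  `RemainderSmallΦ`/`CfgDistΦ`/`CfgDistCauchyΦ` asked only on doubly-χ-good data (`PrintChi.ChiGood … ε₀ μ`), plus the letter `L ≤ M₁` of the On-producer;
  **`k1aChartRowsOnChiChi_of_legRowsGOnChiChi`** (κ := 𝔠.κ − ½, rescaled pair) and **`smallBlocksSlackOnChiAllChi_of_k1aLegRowsGOnChiChi : … → ⟨(i*)χ TEXT VERBATIM⟩**;
  the residual form **`K1aLegRowsROnChiChi`** (five rows over `(Φ, e, B)`, `R := residualRemCore (toCore ∘ p) Φ e B`) with `k1aLegRowsGOnChiChi_of_R` and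
  **`smallBlocksSlackOnChiAllChi_of_k1aLegRowsROnChiChi`**.
UPSHOT: BOTH analytic χ-stubs of v5kC now read ONE interface in print's own currency — per record a rate `a`, rates `κ′ < κ₁`; per χ-package family ONE chart family with vacuum
constants and loop variables carrying (43) `KernelLegPointwiseΦ`, the core K1a `FlatKernelLegCauchyΦ`, and the seventh-order residual row + (44) `CfgDistΦ` + the 19200-side
`CfgDistCauchyΦ` — on the whole sharp window for `L ≥ 7` (`K1aLegRowsRChi`), with the last three restricted to print's χ for `L ∈ {3,5}` (`K1aLegRowsROnChiChi`).
Hypothesis schemas only; nothing of [Balaban1985UV3]/[King1986] is asserted; no numerics; registry untouched (`--supports stmt-QuantumFields-20520`).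

References: T. Bałaban, CMP 102 (1985) 255–275 [Balaban1985UV3] ((27)–(28) p.263, (30) p.263, (43)–(47) pp.266–267, (57) p.270); CMP 109 (1987) 249–301 [Balaban1987RG1] ((0.26) p.257);
C. King, CMP 102 (1986) 649–677 [King1986] (Thm 3.4 (3.9) p.656, Prop. 3.6 (3.56) p.662, Prop. 3.9 (3.71) p.664).
-/

set_option autoImplicit false

noncomputable section

open scoped BigOperators
open Literature.MathematicalPhysics.QuantumFieldTheory.Balaban1983to89
open Literature.MathematicalPhysics.QuantumFieldTheory.Balaban1983to89.T3ContinuumYM3Torus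
open Literature.MathematicalPhysics.QuantumFieldTheory.Balaban1983to89.T3UnitScaleTilt
open Literature.MathematicalPhysics.QuantumFieldTheory.Balaban1983to89.T3LevelShift
open Literature.MathematicalPhysics.QuantumFieldTheory.Balaban1983to89.T3AlphaInputsAC
open Literature.MathematicalPhysics.QuantumFieldTheory.Balaban1983to89.T3AlphaPolymerSocket
open Literature.MathematicalPhysics.QuantumFieldTheory.Balaban1983to89.T3AlphaInputsACTwoRun
open Literature.MathematicalPhysics.QuantumFieldTheory.Balaban1983to89.T3AlphaInputsACTwoRunLevel
open Literature.MathematicalPhysics.QuantumFieldTheory.Balaban1983to89.B12TreeDecay (kappa₀ kappa₀_nonneg)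
open Summit.QuantumFields.Balaban3D.Carriers
open Summit.QuantumFields.Balaban3D.Proofs.Primitives
open Summit.QuantumFields.Balaban3D.Proofs.GroupModelLieC (lieC)
open Summit.QuantumFields.YangMills.Theorems
open Summit.QuantumFields.YangMills.Theorems.GlobalSlackKernelMatching
open Summit.QuantumFields.YangMills.Theorems.GlobalSlackKernelMatchingOn
open Summit.QuantumFields.YangMills.Theorems.GlobalSlackCanonicalPolymers
open Summit.QuantumFields.YangMills.Theorems.GlobalSlackCanonicalOnChi

namespace Summit.QuantumFields.YangMills.Theorems.GlobalSlackKernelLeg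

/-! ## §1 The configuration leg rows read on a window sub-predicate `S` -/

section Rows

variable {𝕍 : Type} [NormedAddCommGroup 𝕍] [NormedSpace ℂ 𝕍] {F : T3Family} {γ : ℝ}

/-- **CONFIGURATION SIZE ROW IN DISTANCE FORM ON `S`**: `CfgDistΦ` (print's (44): leg by leg `‖B(c)‖ ≤ C_s·(1 + d(c))·θ(n)·x²`, both runs) asked only at window data that are
`S`-good for both runs `K` and `K+1`. [cite: Balaban1985UV3, (44) p.267, (27)-(28) p.263, (47) p.267] -/
def CfgDistΦOn (S : WinPred F) (D : AlphaDataT3 F γ) (B : CfgFam 𝕍 F) (dist : LegDist F) (b₀ p₀ C_s : ℝ) : Prop :=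
  ∀ (K n : ℕ) (h : n ≤ K), ∀ j : ℕ, j < K - n →
    ∀ V : GaugeField (F.P n) 0 (Matrix.specialUnitaryGroup (Fin 2) ℂ), PlaqSmall (θBal F.L γ b₀ p₀ n) V →
      S K n h V → S (K + 1) n (h.trans (Nat.le_succ K)) V →
      ∀ Y ∈ D.Loc K (K - n) (D.triv K (K - n)) (1 + j), ∀ c : PBond (F.P K) j,
        ‖B K (K - n) j Y
            (fieldShift (F.sitesPerDir_eq (m := F.m) (K := K) (j := K - n) (m' := F.m) (K' := n) (j' := 0) (by omega)) V) c‖ ≤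
          C_s * (1 + dist K j Y c) * θBal F.L γ b₀ p₀ n * (((F.L : ℝ) ^ (K - n - 1 - j))⁻¹) ^ 2 ∧
        ‖B (K + 1) (K + 1 - n) (j + 1) (refineSet F K Y)
            (fieldShift (F.sitesPerDir_eq (m := F.m) (K := K + 1) (j := K + 1 - n) (m' := F.m) (K' := n) (j' := 0) (by omega)) V)
            (matchBond F K j c)‖ ≤
          C_s * (1 + dist K j Y c) * θBal F.L γ b₀ p₀ n * (((F.L : ℝ) ^ (K - n - 1 - j))⁻¹) ^ 2

/-- **CONFIGURATION CAUCHY ROW IN DISTANCE FORM ON `S`** (the 19200-side content leg by leg, loss-free): `CfgDistCauchyΦ` asked only at doubly-`S`-good window data.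
[cite: King1986, Prop. 3.9 (3.71) p.664; Balaban1985UV3, (44) p.267, (47) p.267] -/
def CfgDistCauchyΦOn (S : WinPred F) (D : AlphaDataT3 F γ) (B : CfgFam 𝕍 F) (dist : LegDist F) (b₀ p₀ a C_B : ℝ) : Prop :=
  ∀ (K n : ℕ) (h : n ≤ K), ∀ j : ℕ, j < K - n →
    ∀ V : GaugeField (F.P n) 0 (Matrix.specialUnitaryGroup (Fin 2) ℂ), PlaqSmall (θBal F.L γ b₀ p₀ n) V →
      S K n h V → S (K + 1) n (h.trans (Nat.le_succ K)) V →
      ∀ Y ∈ D.Loc K (K - n) (D.triv K (K - n)) (1 + j), ∀ c : PBond (F.P K) j,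
        ‖B (K + 1) (K + 1 - n) (j + 1) (refineSet F K Y)
              (fieldShift (F.sitesPerDir_eq (m := F.m) (K := K + 1) (j := K + 1 - n) (m' := F.m) (K' := n) (j' := 0) (by omega)) V)
              (matchBond F K j c) -
            B K (K - n) j Y
              (fieldShift (F.sitesPerDir_eq (m := F.m) (K := K) (j := K - n) (m' := F.m) (K' := n) (j' := 0) (by omega)) V) c‖ ≤
          C_B * (1 + dist K j Y c) * θBal F.L γ b₀ p₀ n * (((F.L : ℝ) ^ (K - n - 1 - j))⁻¹) ^ 2 * (((F.L : ℝ) ^ (1 + j))⁻¹) ^ a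

omit [NormedSpace ℂ 𝕍] in
/-- The full-window distance-form row gives the row on every `S`. [folklore] -/
theorem cfgDistΦOn_of_full (S : WinPred F) {D : AlphaDataT3 F γ} {B : CfgFam 𝕍 F} {dist : LegDist F} {b₀ p₀ C_s : ℝ} (h : CfgDistΦ D B dist b₀ p₀ C_s) :
    CfgDistΦOn S D B dist b₀ p₀ C_s :=
  fun K n hn j hj V hV _ _ Y hY c => h K n hn j hj V hV Y hY c

omit [NormedSpace ℂ 𝕍] in
/-- The full-window distance-form Cauchy row gives the row on every `S`. [folklore] -/
theorem cfgDistCauchyΦOn_of_full (S : WinPred F) {D : AlphaDataT3 F γ} {B : CfgFam 𝕍 F} {dist : LegDist F} {b₀ p₀ a C_B : ℝ} (h : CfgDistCauchyΦ D B dist b₀ p₀ a C_B) :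
    CfgDistCauchyΦOn S D B dist b₀ p₀ a C_B :=
  fun K n hn j hj V hV _ _ Y hY c => h K n hn j hj V hV Y hY c

end Rows

/-! ## §2 The transfers, threaded through `S` -/

section Transfer

variable {𝕍 : Type} [NormedAddCommGroup 𝕍] [NormedSpace ℂ 𝕍] {F : T3Family} {γ : ℝ}

/-- **`CfgSizeΦOn S` for the rescaled configurations from the distance form on `S`**, profile unchanged, constant `C_s·(1 + κ′⁻¹)` — lane A's `cfgSizeΦ_rescaleW` with the two
`S`-hypotheses threaded. [cite: Balaban1985UV3, (44)-(45) p.267, (28) p.263, (47) p.267] -/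
theorem cfgSizeΦOn_rescaleW (S : WinPred F) {D : AlphaDataT3 F γ} {B : CfgFam 𝕍 F} {dist : LegDist F} {b₀ p₀ κ' C_s : ℝ} (hL : 1 ≤ F.L) (hγ : 0 < γ) (hγ1 : γ ≤ 1)
    (hb : 0 < b₀) (hn : DistNonneg dist) (hm : DistMatched dist) (hκ : 0 < κ') (hCs : 0 ≤ C_s)
    (h : CfgDistΦOn S D B dist b₀ p₀ C_s) : CfgSizeΦOn S D (rescaleBw dist κ' B) b₀ p₀ (C_s * (1 + κ'⁻¹)) := by
  intro K n hnK j hj V hV hS hS' Y hY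
  have hθ : 0 ≤ θBal F.L γ b₀ p₀ n := (T3MinimiserStabilityReduction.θBal_pos hL hγ hγ1 hb p₀ n).le
  set x2 : ℝ := (((F.L : ℝ) ^ (K - n - 1 - j))⁻¹) ^ 2 with hx2
  have hx2' : 0 ≤ x2 := by positivity
  have hA : 0 ≤ C_s * θBal F.L γ b₀ p₀ n * x2 := by positivity
  have hrow := h K n hnK j hj V hV hS hS' Y hY
  refine ⟨?_, ?_⟩
  · have hle := norm_weighted_le (𝕍 := 𝕍) hn hκ (K := K) (b := j) (Y := Y) hA
      (B K (K - n) j Y (fieldShift (F.sitesPerDir_eq (m := F.m) (K := K) (j := K - n) (m' := F.m) (K' := n) (j' := 0) (by omega)) V))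
      (fun c => by have := (hrow c).1; nlinarith [this])
    calc _ = ‖(fun c => (legW dist κ' K j Y c)⁻¹ •
          B K (K - n) j Y (fieldShift (F.sitesPerDir_eq (m := F.m) (K := K) (j := K - n) (m' := F.m) (K' := n) (j' := 0) (by omega)) V) c)‖ := rfl
      _ ≤ C_s * θBal F.L γ b₀ p₀ n * x2 * (1 + κ'⁻¹) := hle
      _ = _ := by ring
  · have hle := norm_weighted_le (𝕍 := 𝕍) hn hκ (K := K) (b := j) (Y := Y) hA
      (fun c => B (K + 1) (K + 1 - n) (j + 1) (refineSet F K Y)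
        (fieldShift (F.sitesPerDir_eq (m := F.m) (K := K + 1) (j := K + 1 - n) (m' := F.m) (K' := n) (j' := 0) (by omega)) V) (matchBond F K j c))
      (fun c => by have := (hrow c).2; nlinarith [this])
    have heq : (fun c => rescaleBw dist κ' B (K + 1) (K + 1 - n) (j + 1) (refineSet F K Y)
        (fieldShift (F.sitesPerDir_eq (m := F.m) (K := K + 1) (j := K + 1 - n) (m' := F.m) (K' := n) (j' := 0) (by omega)) V) (matchBond F K j c)) =
        fun c => (legW dist κ' K j Y c)⁻¹ • B (K + 1) (K + 1 - n) (j + 1) (refineSet F K Y)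
          (fieldShift (F.sitesPerDir_eq (m := F.m) (K := K + 1) (j := K + 1 - n) (m' := F.m) (K' := n) (j' := 0) (by omega)) V) (matchBond F K j c) := by
      funext c
      rw [rescaleBw_apply, legW_matched hm]
    rw [heq]
    calc _ ≤ C_s * θBal F.L γ b₀ p₀ n * x2 * (1 + κ'⁻¹) := hle
      _ = _ := by ring

/-- **`CfgCauchyΦOn S (ℓ ≡ 1)` for the rescaled configurations from the distance-form Cauchy row on `S`**, constant `C_B·(1 + κ′⁻¹)` — lane A's `cfgCauchyΦ_rescaleW` with `S`
threaded. [cite: King1986, Prop. 3.9 (3.71) p.664; Balaban1985UV3, (47) p.267] -/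
theorem cfgCauchyΦOn_rescaleW (S : WinPred F) {D : AlphaDataT3 F γ} {B : CfgFam 𝕍 F} {dist : LegDist F} {b₀ p₀ κ' a C_B : ℝ} (hL : 1 ≤ F.L) (hγ : 0 < γ) (hγ1 : γ ≤ 1)
    (hb : 0 < b₀) (hn : DistNonneg dist) (hm : DistMatched dist) (hκ : 0 < κ') (hCB : 0 ≤ C_B)
    (h : CfgDistCauchyΦOn S D B dist b₀ p₀ a C_B) : CfgCauchyΦOn S D (rescaleBw dist κ' B) b₀ p₀ a (C_B * (1 + κ'⁻¹)) fun _ => 1 := by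
  intro K n hnK j hj V hV hS hS' Y hY
  have hθ : 0 ≤ θBal F.L γ b₀ p₀ n := (T3MinimiserStabilityReduction.θBal_pos hL hγ hγ1 hb p₀ n).le
  have hL0 : (0 : ℝ) < F.L := by exact_mod_cast (zero_lt_one.trans_le hL)
  set x2 : ℝ := (((F.L : ℝ) ^ (K - n - 1 - j))⁻¹) ^ 2 with hx2
  set ra : ℝ := (((F.L : ℝ) ^ (1 + j))⁻¹) ^ a with hra
  have hx2' : 0 ≤ x2 := by positivity
  have hra' : 0 ≤ ra := by positivity
  have hA : 0 ≤ C_B * θBal F.L γ b₀ p₀ n * x2 * ra := by positivity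
  have hrow := h K n hnK j hj V hV hS hS' Y hY
  set x' := fun c => B (K + 1) (K + 1 - n) (j + 1) (refineSet F K Y)
    (fieldShift (F.sitesPerDir_eq (m := F.m) (K := K + 1) (j := K + 1 - n) (m' := F.m) (K' := n) (j' := 0) (by omega)) V) (matchBond F K j c) with hx'
  set x := B K (K - n) j Y (fieldShift (F.sitesPerDir_eq (m := F.m) (K := K) (j := K - n) (m' := F.m) (K' := n) (j' := 0) (by omega)) V) with hx
  have hle := norm_weighted_le (𝕍 := 𝕍) hn hκ (K := K) (b := j) (Y := Y) hA (fun c => x' c - x c)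
    (fun c => by have := hrow c; nlinarith [this])
  have heq : ((fun c => rescaleBw dist κ' B (K + 1) (K + 1 - n) (j + 1) (refineSet F K Y)
        (fieldShift (F.sitesPerDir_eq (m := F.m) (K := K + 1) (j := K + 1 - n) (m' := F.m) (K' := n) (j' := 0) (by omega)) V) (matchBond F K j c)) -
        rescaleBw dist κ' B K (K - n) j Y
          (fieldShift (F.sitesPerDir_eq (m := F.m) (K := K) (j := K - n) (m' := F.m) (K' := n) (j' := 0) (by omega)) V)) =
      fun c => (legW dist κ' K j Y c)⁻¹ • (x' c - x c) := by
    funext c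
    rw [Pi.sub_apply, rescaleBw_apply, legW_matched hm, smul_sub]
    rfl
  rw [heq]
  calc _ ≤ C_B * θBal F.L γ b₀ p₀ n * x2 * ra * (1 + κ'⁻¹) := hle
    _ = _ := by ring

omit [NormedAddCommGroup 𝕍] [NormedSpace ℂ 𝕍] in
/-- `RemainderSmallΦOn S` is monotone in the tree decay (nonnegative tree lengths). [folklore] -/
theorem remainderSmallΦOn_mono (S : WinPred F) {D : AlphaDataT3 F γ} {R : RemFam F} {b₀ p₀ κ κ' C_R : ℝ} (hT : ∀ K i Y, 0 ≤ D.treeLen K i Y)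
    (hθ : ∀ n, 0 ≤ θBal F.L γ b₀ p₀ n) (hκ : κ' ≤ κ) (hC : 0 ≤ C_R) (h : RemainderSmallΦOn S D R b₀ p₀ κ C_R) :
    RemainderSmallΦOn S D R b₀ p₀ κ' C_R := by
  intro K n hn j hj V hV hS hS' Y hY
  obtain ⟨h1, h2⟩ := h K n hn j hj V hV hS hS' Y hY
  have hfac : C_R * Real.exp (-κ * D.treeLen K (1 + j) Y) * θBal F.L γ b₀ p₀ n ^ 7 * (((F.L : ℝ) ^ (K - n - 1 - j))⁻¹) ^ 4 ≤
      C_R * Real.exp (-κ' * D.treeLen K (1 + j) Y) * θBal F.L γ b₀ p₀ n ^ 7 * (((F.L : ℝ) ^ (K - n - 1 - j))⁻¹) ^ 4 :=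
    mul_le_mul_of_nonneg_right (mul_le_mul_of_nonneg_right
      (mul_le_mul_of_nonneg_left (Real.exp_le_exp.mpr (by nlinarith [hT K (1 + j) Y])) hC) (pow_nonneg (hθ n) 7)) (by positivity)
  exact ⟨h1.trans hfac, h2.trans hfac⟩

end Transfer

/-! ## §3 The leg rows at the χ-record with the three configuration rows on print's χ, and the registered stub (i*)χ -/

variable {F : T3Family} {𝔠 : AlphaConsts F.L (suGroupModel 2).N} {γ : ℝ} {hγ : 0 < γ} {hγ1 : γ ≤ (min 𝔠.gamma0 1) ^ 2}

/-- **THE K1a LEG ROWS AT THE χ-RECORD, GEOMETRY DISCHARGED, THE RESIDUAL/CONFIGURATION ROWS ON χ-GOOD DATA** (hypothesis schema, never asserted): `K1aLegRowsGChi` with ONE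
change — for every regularity threshold `0 < ε₀ ≤ a₀` the rows `RemainderSmallΦ`, (44) `CfgDistΦ`, `CfgDistCauchyΦ` are asked only at window data that are χ-good with margin `μ`
for BOTH runs (`PrintChi.ChiGood F γ b₀ p₀ ε₀ μ`), the chart carriers being allowed to depend on `ε₀`; the configuration-free rows `TaylorSplitΦ (canonPTCore (toCore ∘ p))`, K1a
`FlatKernelLegCauchyΦ`, (43) `KernelLegPointwiseΦ` at the canonical leg distance `canonLegDist F` are VERBATIM; plus the On-producer's letter `L ≤ M₁`.
[cite: Balaban1985UV3, (43)-(47) pp.266-267, (57) p.270; King1986, Prop. 3.6 (3.56) p.662, Prop. 3.9 (3.71) p.664] -/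
def K1aLegRowsGOnChiChi (L : ℕ) (μ : ℝ) (𝔠 : AlphaConsts L (suGroupModel 2).N) (a₀ a₁ a : ℝ) : Prop :=
  ∃ (κ' κ₁ C A C_R C_s C_B γB : ℝ), 0 < κ' ∧ κ' < κ₁ ∧ 0 ≤ C ∧ 0 ≤ A ∧ 0 ≤ C_R ∧ 0 ≤ C_s ∧ 0 ≤ C_B ∧ 0 < γB ∧
    L ≤ 𝔠.M₁ ∧
    ∀ (F : T3Family) (γ : ℝ) (hF : F.L = L) (hγ : 0 < γ), γ ≤ γB → ∀ (hγ1 : γ ≤ (min (hF ▸ 𝔠).gamma0 1) ^ 2),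
      AlphaInputsT3AC.OfV3ChiAt F (hF ▸ 𝔠) a₀ a₁ →
        ∃ (p : ∀ K, AlphaInputsT3AC.PkgAtV3Chi F (hF ▸ 𝔠) γ hγ hγ1 K), (∀ K, (p K).a₀ = a₀ ∧ (p K).a₁ = a₁) ∧
          ∀ ε₀ : ℝ, 0 < ε₀ → ε₀ ≤ a₀ →
          ∃ (Φ : ChartFam ↥(lieC (suGroupModel 2)) F) (e : VacFam F) (B : CfgFam ↥(lieC (suGroupModel 2)) F) (R : RemFam F),
            TaylorSplitΦ (canonPTCore fun K => (p K).toCore) Φ e B R ∧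
            FlatKernelLegCauchyΦ (AlphaInputsT3AC.dataOfV3chi p (canonPolymerCore fun K => (p K).toCore)) Φ (canonLegDist F) κ' (hF ▸ 𝔠).κ a C ∧
            KernelLegPointwiseΦ (AlphaInputsT3AC.dataOfV3chi p (canonPolymerCore fun K => (p K).toCore)) Φ (canonLegDist F) κ₁ (hF ▸ 𝔠).κ A ∧
            RemainderSmallΦOn (fun K n h V => PrintChi.ChiGood F γ (hF ▸ 𝔠).b₀ (hF ▸ 𝔠).p₀ ε₀ μ (n := n) (K := K) h V)
              (AlphaInputsT3AC.dataOfV3chi p (canonPolymerCore fun K => (p K).toCore)) R (hF ▸ 𝔠).b₀ (hF ▸ 𝔠).p₀ (hF ▸ 𝔠).κ C_R ∧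
            CfgDistΦOn (fun K n h V => PrintChi.ChiGood F γ (hF ▸ 𝔠).b₀ (hF ▸ 𝔠).p₀ ε₀ μ (n := n) (K := K) h V)
              (AlphaInputsT3AC.dataOfV3chi p (canonPolymerCore fun K => (p K).toCore)) B (canonLegDist F) (hF ▸ 𝔠).b₀ (hF ▸ 𝔠).p₀ C_s ∧
            CfgDistCauchyΦOn (fun K n h V => PrintChi.ChiGood F γ (hF ▸ 𝔠).b₀ (hF ▸ 𝔠).p₀ ε₀ μ (n := n) (K := K) h V)
              (AlphaInputsT3AC.dataOfV3chi p (canonPolymerCore fun K => (p K).toCore)) B (canonLegDist F) (hF ▸ 𝔠).b₀ (hF ▸ 𝔠).p₀ a C_B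

/-- **THE On-χ LEG ROWS GIVE THE On-χ CHART ROWS at `κ := 𝔠.κ − ½`** through the rescaled pair `(Φ∘D_w, D_w⁻¹B)` for each `ε₀` (`S := max 1 (legSumConst L 𝔠 (κ₁ − κ′))` by
`legSummableT_canonCore`, `C_E := A·S⁶·12⁶`, `C_s`, `C_B` times `1 + κ′⁻¹`) — lane A's `k1aChartRowsC_of_legRowsT ∘ k1aLegRowsT_of_G` at the χ-datum with the three On rows
transferred by §2. [cite: Balaban1985UV3, (43)-(45) pp.266-267, (47) p.267; Balaban1987RG1, (0.26) p.257] -/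
theorem k1aChartRowsOnChiChi_of_legRowsGOnChiChi {L : ℕ} {μ : ℝ} {𝔠 : AlphaConsts L (suGroupModel 2).N} {a₀ a₁ a : ℝ} (h : K1aLegRowsGOnChiChi L μ 𝔠 a₀ a₁ a) :
    K1aChartRowsOnChiChi L μ 𝔠 a₀ a₁ a := by
  obtain ⟨κ', κ₁, C, A, C_R, C_s, C_B, γB, hκ', hκ1, hC, hA, hCR, hCs, hCB, hγB, hM, hall⟩ := h
  have hk1 : 0 ≤ 1 + κ'⁻¹ := by positivity
  have hκhalf : kappa₀ (4 * 2 ^ 3) (2 * 3) ≤ 𝔠.κ - 1 / 2 ∧ 0 < 𝔠.κ - 1 / 2 := by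
    have hge := 𝔠.kappa_ge
    have h0 : 0 ≤ kappa₀ (4 * 2 ^ 3) (2 * 3) := kappa₀_nonneg (by norm_num) _
    set k := kappa₀ (4 * 2 ^ 3) (2 * 3) with hk
    constructor <;> linarith
  set S : ℝ := max 1 (legSumConst L 𝔠 (κ₁ - κ')) with hSdef
  have hS : 1 ≤ S := le_max_left _ _
  set C_E : ℝ := A * S ^ 6 * (6 / (1 / 2 : ℝ)) ^ 6 with hCE
  have hCE0 : 0 ≤ C_E := by rw [hCE]; have := zero_le_one.trans hS; positivity
  refine ⟨𝔠.κ - 1 / 2, C, C_E, C_R, C_s * (1 + κ'⁻¹), C_B * (1 + κ'⁻¹), γB, hκhalf.2, by linarith, hκhalf.1, hC, hCE0, hCR,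
    mul_nonneg hCs hk1, mul_nonneg hCB hk1, hγB, hM, fun F γ hF hγ hγle hγ1 hOf => ?_⟩
  subst hF
  obtain ⟨p, hp, hrows⟩ := hall F γ rfl hγ hγle hγ1 hOf
  refine ⟨p, hp, fun ε₀ hε hεa => ?_⟩
  obtain ⟨Φ, e, B, R, hT, hK, hP, hR, hSz, hBC⟩ := hrows ε₀ hε hεa
  have hL : 1 ≤ F.L := F.hL.2.le
  have hγ1' : γ ≤ 1 := hγ1.trans (sq_min_one_le _ 𝔠.gamma0_pos)
  have hTl : ∀ K i Y, 0 ≤ (AlphaInputsT3AC.dataOfV3chi p (canonPolymerCore fun K => (p K).toCore)).treeLen K i Y :=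
    fun K i Y => canonTreeLenCore_nonneg (fun K => (p K).toCore) K i Y
  have hθ : ∀ n, 0 ≤ θBal F.L γ 𝔠.b₀ 𝔠.p₀ n := fun n => (T3MinimiserStabilityReduction.θBal_pos hL hγ hγ1' 𝔠.b₀_pos 𝔠.p₀ n).le
  have hn := canonLegDist_nonneg F
  have hm := canonLegDist_matched F
  have hsum : LegSummableT (AlphaInputsT3AC.dataOfV3chi p (canonPolymerCore fun K => (p K).toCore)) (canonLegDist F) (κ₁ - κ') S :=
    legSummableT_mono_S hTl (le_max_right _ _) (legSummableT_canonCore (fun K => (p K).toCore) (by linarith))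
  have hE : KernelLegΦ (AlphaInputsT3AC.dataOfV3chi p (canonPolymerCore fun K => (p K).toCore)) Φ (canonLegDist F) κ' (𝔠.κ - 1 / 2) C_E :=
    kernelLegΦ_of_pointwise_T hn hTl (by linarith) hA hS (by norm_num) (by norm_num) hP hsum
  have hK' := flatKernelLegCauchyΦ_mono hTl (show 𝔠.κ - 1 / 2 ≤ 𝔠.κ by linarith) hC hK
  have hR' := remainderSmallΦOn_mono _ hTl hθ (show 𝔠.κ - 1 / 2 ≤ 𝔠.κ by linarith) hCR hR
  exact ⟨rescaleΦw (canonLegDist F) κ' Φ, e, rescaleBw (canonLegDist F) κ' B, R, taylorSplitΦ_rescaleW (canonLegDist F) κ' hT,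
    flatKernelCauchyΦ_rescaleW hm hK', kernelSizeΦ_rescaleW hE, hR',
    cfgSizeΦOn_rescaleW _ hL hγ hγ1' 𝔠.b₀_pos hn hm hκ' hCs hSz, cfgCauchyΦOn_rescaleW _ hL hγ hγ1' 𝔠.b₀_pos hn hm hκ' hCB hBC⟩

/-- **THE REGISTERED STUB (i*)χ FROM THE LEG ROWS WITH THE THREE CONFIGURATION ROWS ON PRINT'S χ, BY NAME** (`smallBlocksSlackOnChiAllChi_of_k1aChartRowsOnChiChi ∘
k1aChartRowsOnChiChi_of_legRowsGOnChiChi`): if for every odd `1 < L < 7`, every margin `μ ∈ (0,1)`, every constants record and [7]-constants there is `0 < a < 1` with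
`K1aLegRowsGOnChiChi L μ 𝔠 a₀ a₁ a`, then the text of `stub_smallBlocksSlackOnChiAllChi` (skeleton v5kC of stmt-QuantumFields-20520) holds VERBATIM.
[cite: Balaban1985UV3, (43)-(47) pp.266-267, (57) p.270; King1986, Thm 3.4 (3.9) p.656, Prop. 3.6 p.662] -/
theorem smallBlocksSlackOnChiAllChi_of_k1aLegRowsGOnChiChi
    (h : ∀ (L : ℕ), Odd L → 1 < L → L < 7 → ∀ (μ : ℝ), 0 < μ → μ < 1 → ∀ (𝔠 : AlphaConsts L (suGroupModel 2).N) (a₀ a₁ : ℝ),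
      0 < a₀ → 0 < a₁ → 𝔠.B₃ * a₁ ≤ a₀ → ∃ a : ℝ, 0 < a ∧ a < 1 ∧ K1aLegRowsGOnChiChi L μ 𝔠 a₀ a₁ a) :
    ∀ (L : ℕ), Odd L → 1 < L → L < 7 → ∀ (μ : ℝ), 0 < μ → μ < 1 →
      ∀ (𝔠 : Summit.QuantumFields.Balaban3D.Proofs.Primitives.AlphaConsts L (Summit.QuantumFields.Balaban3D.Carriers.suGroupModel 2).N)
        (a₀ a₁ : ℝ), 0 < a₀ → 0 < a₁ → 𝔠.B₃ * a₁ ≤ a₀ →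
        ∃ a : ℝ, 0 < a ∧ ∃ γB : ℝ, 0 < γB ∧ ∀ (F : T3Family) (γ : ℝ) (hF : F.L = L) (hγ : 0 < γ), γ ≤ γB →
          ∀ (hγ1 : γ ≤ (min (hF ▸ 𝔠).gamma0 1) ^ 2),
            Summit.QuantumFields.YangMills.Theorems.AlphaInputsT3AC.OfV3ChiAt F (hF ▸ 𝔠) a₀ a₁ →
            ∃ (p : ∀ K, Summit.QuantumFields.YangMills.Theorems.AlphaInputsT3AC.PkgAtV3Chi F (hF ▸ 𝔠) γ hγ hγ1 K),
              (∀ K, (p K).a₀ = a₀ ∧ (p K).a₁ = a₁) ∧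
              ∃ (π : Summit.QuantumFields.YangMills.Theorems.AlphaInputsT3AC.PolymerT3 F) (σ : ℕ) (C : ℝ), 7 ≤ σ ∧ 0 ≤ C ∧
                ∀ ε₀ : ℝ, 0 < ε₀ → ε₀ ≤ a₀ →
                  Summit.QuantumFields.YangMills.Theorems.PrintChi.GlobalSupRateTSlackOn
                    (fun K n h V => Summit.QuantumFields.YangMills.Theorems.PrintChi.ChiGood F γ (hF ▸ 𝔠).b₀ (hF ▸ 𝔠).p₀ ε₀ μ (n := n) (K := K) h V)
                    (Summit.QuantumFields.YangMills.Theorems.AlphaInputsT3AC.dataOfV3chi p π) (hF ▸ 𝔠).b₀ (hF ▸ 𝔠).p₀ a σ C :=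
  smallBlocksSlackOnChiAllChi_of_k1aChartRowsOnChiChi fun L hLo hL1 hL7 μ hμ0 hμ1 𝔠 a₀ a₁ ha0 ha1 hw => by
    obtain ⟨a, ha, ha1', hc⟩ := h L hLo hL1 hL7 μ hμ0 hμ1 𝔠 a₀ a₁ ha0 ha1 hw
    exact ⟨a, ha, ha1', k1aChartRowsOnChiChi_of_legRowsGOnChiChi hc⟩

/-- **THE On-χ LEG ROWS OVER `(Φ, e, B)` ONLY** (hypothesis schema, never asserted): `K1aLegRowsGOnChiChi` with the rest ELIMINATED — for each `ε₀` the remainder row is stated for the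
RESIDUAL `residualRemCore (toCore ∘ p) Φ e B` ((M1) to seventh order + the far terms, on χ-good data); plus K1a `FlatKernelLegCauchyΦ`, (43) `KernelLegPointwiseΦ` (full window) and
(44) `CfgDistΦOn`/`CfgDistCauchyΦOn` (on χ) at the canonical leg distance; letter `L ≤ M₁`. [cite: Balaban1985UV3, (43)-(44) pp.266-267, (47) p.267, (57) p.270; King1986, Prop. 3.6 (3.56) p.662, Prop. 3.9 (3.71) p.664] -/
def K1aLegRowsROnChiChi (L : ℕ) (μ : ℝ) (𝔠 : AlphaConsts L (suGroupModel 2).N) (a₀ a₁ a : ℝ) : Prop :=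
  ∃ (κ' κ₁ C A C_R C_s C_B γB : ℝ), 0 < κ' ∧ κ' < κ₁ ∧ 0 ≤ C ∧ 0 ≤ A ∧ 0 ≤ C_R ∧ 0 ≤ C_s ∧ 0 ≤ C_B ∧ 0 < γB ∧
    L ≤ 𝔠.M₁ ∧
    ∀ (F : T3Family) (γ : ℝ) (hF : F.L = L) (hγ : 0 < γ), γ ≤ γB → ∀ (hγ1 : γ ≤ (min (hF ▸ 𝔠).gamma0 1) ^ 2),
      AlphaInputsT3AC.OfV3ChiAt F (hF ▸ 𝔠) a₀ a₁ →
        ∃ (p : ∀ K, AlphaInputsT3AC.PkgAtV3Chi F (hF ▸ 𝔠) γ hγ hγ1 K), (∀ K, (p K).a₀ = a₀ ∧ (p K).a₁ = a₁) ∧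
          ∀ ε₀ : ℝ, 0 < ε₀ → ε₀ ≤ a₀ →
          ∃ (Φ : ChartFam ↥(lieC (suGroupModel 2)) F) (e : VacFam F) (B : CfgFam ↥(lieC (suGroupModel 2)) F),
            FlatKernelLegCauchyΦ (AlphaInputsT3AC.dataOfV3chi p (canonPolymerCore fun K => (p K).toCore)) Φ (canonLegDist F) κ' (hF ▸ 𝔠).κ a C ∧
            KernelLegPointwiseΦ (AlphaInputsT3AC.dataOfV3chi p (canonPolymerCore fun K => (p K).toCore)) Φ (canonLegDist F) κ₁ (hF ▸ 𝔠).κ A ∧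
            RemainderSmallΦOn (fun K n h V => PrintChi.ChiGood F γ (hF ▸ 𝔠).b₀ (hF ▸ 𝔠).p₀ ε₀ μ (n := n) (K := K) h V)
              (AlphaInputsT3AC.dataOfV3chi p (canonPolymerCore fun K => (p K).toCore)) (residualRemCore (fun K => (p K).toCore) Φ e B)
              (hF ▸ 𝔠).b₀ (hF ▸ 𝔠).p₀ (hF ▸ 𝔠).κ C_R ∧
            CfgDistΦOn (fun K n h V => PrintChi.ChiGood F γ (hF ▸ 𝔠).b₀ (hF ▸ 𝔠).p₀ ε₀ μ (n := n) (K := K) h V)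
              (AlphaInputsT3AC.dataOfV3chi p (canonPolymerCore fun K => (p K).toCore)) B (canonLegDist F) (hF ▸ 𝔠).b₀ (hF ▸ 𝔠).p₀ C_s ∧
            CfgDistCauchyΦOn (fun K n h V => PrintChi.ChiGood F γ (hF ▸ 𝔠).b₀ (hF ▸ 𝔠).p₀ ε₀ μ (n := n) (K := K) h V)
              (AlphaInputsT3AC.dataOfV3chi p (canonPolymerCore fun K => (p K).toCore)) B (canonLegDist F) (hF ▸ 𝔠).b₀ (hF ▸ 𝔠).p₀ a C_B

/-- The five On-χ rows give the six (`R := residualRemCore (toCore ∘ p) Φ e B`, `TaylorSplitΦ` by definition). [cite: Balaban1985UV3, (43) p.266] -/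
theorem k1aLegRowsGOnChiChi_of_R {L : ℕ} {μ : ℝ} {𝔠 : AlphaConsts L (suGroupModel 2).N} {a₀ a₁ a : ℝ} (h : K1aLegRowsROnChiChi L μ 𝔠 a₀ a₁ a) :
    K1aLegRowsGOnChiChi L μ 𝔠 a₀ a₁ a := by
  obtain ⟨κ', κ₁, C, A, C_R, C_s, C_B, γB, hκ', hκ1, hC, hA, hCR, hCs, hCB, hγB, hM, hall⟩ := h
  refine ⟨κ', κ₁, C, A, C_R, C_s, C_B, γB, hκ', hκ1, hC, hA, hCR, hCs, hCB, hγB, hM, fun F γ hF hγ hγle hγ1 hOf => ?_⟩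
  obtain ⟨p, hp, hrows⟩ := hall F γ hF hγ hγle hγ1 hOf
  refine ⟨p, hp, fun ε₀ hε hεa => ?_⟩
  obtain ⟨Φ, e, B, hK, hP, hR, hS, hBC⟩ := hrows ε₀ hε hεa
  exact ⟨Φ, e, B, residualRemCore (fun K => (p K).toCore) Φ e B, taylorSplitΦ_residualCore (fun K => (p K).toCore) Φ e B, hK, hP, hR, hS, hBC⟩

/-- **THE REGISTERED STUB (i*)χ FROM FIVE On-χ LEG ROWS OVER `(Φ, e, B)`, BY NAME** (`smallBlocksSlackOnChiAllChi_of_k1aLegRowsGOnChiChi ∘ k1aLegRowsGOnChiChi_of_R`).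
[cite: Balaban1985UV3, (43)-(47) pp.266-267, (57) p.270; King1986, Thm 3.4 (3.9) p.656, Prop. 3.6 p.662] -/
theorem smallBlocksSlackOnChiAllChi_of_k1aLegRowsROnChiChi
    (h : ∀ (L : ℕ), Odd L → 1 < L → L < 7 → ∀ (μ : ℝ), 0 < μ → μ < 1 → ∀ (𝔠 : AlphaConsts L (suGroupModel 2).N) (a₀ a₁ : ℝ),
      0 < a₀ → 0 < a₁ → 𝔠.B₃ * a₁ ≤ a₀ → ∃ a : ℝ, 0 < a ∧ a < 1 ∧ K1aLegRowsROnChiChi L μ 𝔠 a₀ a₁ a) :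
    ∀ (L : ℕ), Odd L → 1 < L → L < 7 → ∀ (μ : ℝ), 0 < μ → μ < 1 →
      ∀ (𝔠 : Summit.QuantumFields.Balaban3D.Proofs.Primitives.AlphaConsts L (Summit.QuantumFields.Balaban3D.Carriers.suGroupModel 2).N)
        (a₀ a₁ : ℝ), 0 < a₀ → 0 < a₁ → 𝔠.B₃ * a₁ ≤ a₀ →
        ∃ a : ℝ, 0 < a ∧ ∃ γB : ℝ, 0 < γB ∧ ∀ (F : T3Family) (γ : ℝ) (hF : F.L = L) (hγ : 0 < γ), γ ≤ γB →
          ∀ (hγ1 : γ ≤ (min (hF ▸ 𝔠).gamma0 1) ^ 2),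
            Summit.QuantumFields.YangMills.Theorems.AlphaInputsT3AC.OfV3ChiAt F (hF ▸ 𝔠) a₀ a₁ →
            ∃ (p : ∀ K, Summit.QuantumFields.YangMills.Theorems.AlphaInputsT3AC.PkgAtV3Chi F (hF ▸ 𝔠) γ hγ hγ1 K),
              (∀ K, (p K).a₀ = a₀ ∧ (p K).a₁ = a₁) ∧
              ∃ (π : Summit.QuantumFields.YangMills.Theorems.AlphaInputsT3AC.PolymerT3 F) (σ : ℕ) (C : ℝ), 7 ≤ σ ∧ 0 ≤ C ∧
                ∀ ε₀ : ℝ, 0 < ε₀ → ε₀ ≤ a₀ →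
                  Summit.QuantumFields.YangMills.Theorems.PrintChi.GlobalSupRateTSlackOn
                    (fun K n h V => Summit.QuantumFields.YangMills.Theorems.PrintChi.ChiGood F γ (hF ▸ 𝔠).b₀ (hF ▸ 𝔠).p₀ ε₀ μ (n := n) (K := K) h V)
                    (Summit.QuantumFields.YangMills.Theorems.AlphaInputsT3AC.dataOfV3chi p π) (hF ▸ 𝔠).b₀ (hF ▸ 𝔠).p₀ a σ C :=
  smallBlocksSlackOnChiAllChi_of_k1aLegRowsGOnChiChi fun L hLo hL1 hL7 μ hμ0 hμ1 𝔠 a₀ a₁ ha0 ha1 hw => by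
    obtain ⟨a, ha, ha1', hc⟩ := h L hLo hL1 hL7 μ hμ0 hμ1 𝔠 a₀ a₁ ha0 ha1 hw
    exact ⟨a, ha, ha1', k1aLegRowsGOnChiChi_of_R hc⟩

end Summit.QuantumFields.YangMills.Theorems.GlobalSlackKernelLeg

end
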